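import Mathlib
import Literature.Combinatorics.Additive.TripleProductProperty

/-!
# `SnSubsetDichotomy.ThresholdSubsetTriples`, line `triality-uniquely-cubing-translate` — full-block cap
# (Negative-side helper of crux `stmt-MatrixMultiplication-10882`, lead a1-0; valid at EVERY `n`)

A ℤ/3-symmetric witness `(S, gS, g²S)` of the triple product property in `S_n` cannot concede a large
SYMMETRIC-GROUP coset: if `S ⊇ a·Sym(W)` (every permutation supported inside `W`, left-translated by `a`,
lies in `S`), then `3·|W| ≤ n + 3` (`stub_fullBlockCap`).  Proof: `Q(S) = SS⁻¹ ⊇ Sym(V)` with `V = a(W)`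
(`swap x y · a ∈ S` and `a ∈ S`), and the TPP of `(S, gS, g²S)` forces `Q(S) ∩ gQ(S)g⁻¹ = {1}`; a
transposition of two points of `V ∩ gV` lies in both, so `|V ∩ gV| ≤ 1`, likewise `|V ∩ g²V| ≤ 1` and
`|gV ∩ g²V| ≤ 1`; inclusion–exclusion on `V ∪ gV ∪ g²V ⊆ Fin n` gives `3|V| - 3 ≤ n`.  No hypothesis on
`g` is needed.

For the host family of `stub_trialityChainDesign` (chain products `S = R_0 ⋯ R_{k-1}` along the point
stabiliser chain of levels of size `≤ 3`): if the levels `j ≥ i` are FULL transversals then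
`S ⊇ r·K_i = r·Sym(Ω_i)` and so the full bottom block spans `|Ω_i| ≤ n/3 + 1` points — at most a third of
the chain can be conceded whole (the `n = 9` record `(2, 12, 6)` concedes exactly the last level).  This
complements the asymptotic coset cap `|K|·|S|² ≤ n!·d_max` (`stub_cosetCap`, subgroup-pivot sieve), which
alone would allow a full block on `≈ n/2` points.
-/

set_option linter.dupNamespace false

namespace Summit.MatrixMultiplication.MatrixMultiplication.Theorems.ThresholdSubsetTriples

open Literature.Combinatorics.Additive

section FullBlock

/-- One transposition step: if `x ≠ y` both lie in `V = a(W)` and in `h(V)`, where every permutation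
supported in `W` gives an element `a·σ ∈ S`, then the TPP word
`(swap x y · a)·a⁻¹ · (h·(swap (h⁻¹x) (h⁻¹y) · a))·(h·a)⁻¹ · 1 = 1` is non-trivial — so the pair TPP
hypothesis `hpair` is contradicted.  Stated as: such `x, y` are equal. -/
theorem eq_of_mem_inter_image {n : ℕ} (h a : Equiv.Perm (Fin n)) (S : Finset (Equiv.Perm (Fin n)))
    (W : Finset (Fin n))
    (hpair : ∀ s ∈ S, ∀ s' ∈ S, ∀ t ∈ S, ∀ t' ∈ S,
      s * s'⁻¹ * (h * t * (h * t')⁻¹) = 1 → s = s')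
    (hK : ∀ σ : Equiv.Perm (Fin n), (∀ z, z ∉ W → σ z = z) → a * σ ∈ S)
    {x y : Fin n} (hx : x ∈ W.image a ∩ (W.image a).image h)
    (hy : y ∈ W.image a ∩ (W.image a).image h) : x = y := by
  classical
  by_contra hxy
  rw [Finset.mem_inter] at hx hy
  -- membership facts
  have hxV : x ∈ W.image a := hx.1
  have hyV : y ∈ W.image a := hy.1
  have hxhV : h⁻¹ x ∈ W.image a := by
    obtain ⟨v, hv, hvx⟩ := Finset.mem_image.1 hx.2
    rw [← hvx]; simpa using hv
  have hyhV : h⁻¹ y ∈ W.image a := by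
    obtain ⟨v, hv, hvy⟩ := Finset.mem_image.1 hy.2
    rw [← hvy]; simpa using hv
  -- a transposition of two points of V, conjugated into W, is supported in W
  have supp : ∀ p q : Fin n, p ∈ W.image a → q ∈ W.image a →
      ∀ z, z ∉ W → (a⁻¹ * Equiv.swap p q * a) z = z := by
    intro p q hp hq z hz
    have haz : a z ≠ p := by
      rintro rfl
      obtain ⟨w, hw, hwz⟩ := Finset.mem_image.1 hp
      exact hz ((a.injective hwz) ▸ hw)
    have haz' : a z ≠ q := by
      rintro rfl
      obtain ⟨w, hw, hwz⟩ := Finset.mem_image.1 hq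
      exact hz ((a.injective hwz) ▸ hw)
    simp [Equiv.Perm.mul_apply, Equiv.swap_apply_of_ne_of_ne haz haz']
  have hs : Equiv.swap x y * a ∈ S := by
    have := hK (a⁻¹ * Equiv.swap x y * a) (supp x y hxV hyV)
    rwa [show a * (a⁻¹ * Equiv.swap x y * a) = Equiv.swap x y * a by group] at this
  have ht : Equiv.swap (h⁻¹ x) (h⁻¹ y) * a ∈ S := by
    have := hK (a⁻¹ * Equiv.swap (h⁻¹ x) (h⁻¹ y) * a) (supp _ _ hxhV hyhV)
    rwa [show a * (a⁻¹ * Equiv.swap (h⁻¹ x) (h⁻¹ y) * a) = Equiv.swap (h⁻¹ x) (h⁻¹ y) * a by group]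
      at this
  have ha : a ∈ S := by
    have := hK 1 (fun z _ => rfl)
    rwa [mul_one] at this
  -- the conjugated transposition is `swap x y`
  have hconj : h * Equiv.swap (h⁻¹ x) (h⁻¹ y) * h⁻¹ = Equiv.swap x y := by
    rw [← Equiv.swap_apply_apply h (h⁻¹ x) (h⁻¹ y)]
    simp
  have hword : Equiv.swap x y * a * a⁻¹ *
      (h * (Equiv.swap (h⁻¹ x) (h⁻¹ y) * a) * (h * a)⁻¹) = 1 := by
    calc Equiv.swap x y * a * a⁻¹ * (h * (Equiv.swap (h⁻¹ x) (h⁻¹ y) * a) * (h * a)⁻¹)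
        = Equiv.swap x y * (h * Equiv.swap (h⁻¹ x) (h⁻¹ y) * h⁻¹) := by group
      _ = Equiv.swap x y * Equiv.swap x y := by rw [hconj]
      _ = 1 := Equiv.swap_mul_self x y
  have key := hpair _ hs _ ha _ ht _ ha hword
  have h1 : Equiv.swap x y = 1 := by
    have := congrArg (· * a⁻¹) key
    simpa using this
  exact hxy (Equiv.swap_eq_one_iff.1 h1)

/-- **Full-block cap** (registered stub `stub_fullBlockCap` of crux `stmt-MatrixMultiplication-10882`):
if `(S, gS, g²S)` has the triple product property in `S_n` and `S ⊇ a·Sym(W)` — every permutation fixing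
the complement of `W` pointwise, left-translated by `a`, lies in `S` — then `3·|W| ≤ n + 3`.  Valid for
every `n` and every `g` (for `g = 1` it degenerates to `|W| ≤ 1`). -/
theorem stub_fullBlockCap {n : ℕ} (g a : Equiv.Perm (Fin n)) (S : Finset (Equiv.Perm (Fin n))) (W : Finset (Fin n))
    (hT : TripleProductProperty S (S.image (g * ·)) (S.image (g * g * ·)))
    (hK : ∀ σ : Equiv.Perm (Fin n), (∀ z, z ∉ W → σ z = z) → a * σ ∈ S) :
    3 * W.card ≤ n + 3 := by
  classical
  have ha : a ∈ S := by
    have := hK 1 (fun z _ => rfl)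
    rwa [mul_one] at this
  -- pair conditions extracted from the TPP
  have hpair1 : ∀ s ∈ S, ∀ s' ∈ S, ∀ t ∈ S, ∀ t' ∈ S, s * s'⁻¹ * (g * t * (g * t')⁻¹) = 1 → s = s' := by
    intro s hs s' hs' t ht t' ht' hw
    have := hT s hs s' hs' (g * t) (Finset.mem_image_of_mem _ ht) (g * t') (Finset.mem_image_of_mem _ ht')
      (g * g * a) (Finset.mem_image_of_mem _ ha) (g * g * a) (Finset.mem_image_of_mem _ ha)
      (by rw [mul_inv_cancel, mul_one]; exact hw)
    exact this.1
  have hpair2 : ∀ s ∈ S, ∀ s' ∈ S, ∀ t ∈ S, ∀ t' ∈ S,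
      s * s'⁻¹ * (g * g * t * (g * g * t')⁻¹) = 1 → s = s' := by
    intro s hs s' hs' t ht t' ht' hw
    have := hT s hs s' hs' (g * a) (Finset.mem_image_of_mem _ ha) (g * a) (Finset.mem_image_of_mem _ ha)
      (g * g * t) (Finset.mem_image_of_mem _ ht) (g * g * t') (Finset.mem_image_of_mem _ ht')
      (by rw [mul_inv_cancel, mul_one]; exact hw)
    exact this.1
  set V : Finset (Fin n) := W.image a with hV
  set A := V.image g with hA
  set B := V.image (g * g) with hB
  have hVc : V.card = W.card := Finset.card_image_of_injective _ a.injective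
  have hAc : A.card = W.card := by rw [hA, Finset.card_image_of_injective _ g.injective, hVc]
  have hBc : B.card = W.card := by rw [hB, Finset.card_image_of_injective _ (g * g).injective, hVc]
  -- pairwise intersections have at most one element
  have hVA : (V ∩ A).card ≤ 1 :=
    Finset.card_le_one.2 fun x hx y hy => eq_of_mem_inter_image g a S W hpair1 hK hx hy
  have hVB : (V ∩ B).card ≤ 1 :=
    Finset.card_le_one.2 fun x hx y hy => eq_of_mem_inter_image (g * g) a S W hpair2 hK hx hy
  have hAB : (A ∩ B).card ≤ 1 := by
    have himg : A ∩ B = (V ∩ A).image g := by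
      ext z
      simp only [hA, hB, Finset.mem_inter, Finset.mem_image, Equiv.Perm.mul_apply]
      constructor
      · rintro ⟨⟨v, hv, rfl⟩, ⟨w, hw, hwv⟩⟩
        refine ⟨v, ⟨hv, ⟨w, hw, g.injective hwv⟩⟩, rfl⟩
      · rintro ⟨v, ⟨hv, ⟨w, hw, rfl⟩⟩, rfl⟩
        exact ⟨⟨_, hv, rfl⟩, ⟨w, hw, rfl⟩⟩
    rw [himg]
    exact (Finset.card_image_le).trans hVA
  -- inclusion–exclusion
  have hU : (V ∪ A ∪ B).card ≤ n := by
    simpa using Finset.card_le_univ (V ∪ A ∪ B)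
  have h1 := Finset.card_union_add_card_inter V A
  have h2 := Finset.card_union_add_card_inter (V ∪ A) B
  have h3 : ((V ∪ A) ∩ B).card ≤ (V ∩ B).card + (A ∩ B).card := by
    rw [Finset.union_inter_distrib_right]
    exact Finset.card_union_le _ _
  omega

end FullBlock

end Summit.MatrixMultiplication.MatrixMultiplication.Theorems.ThresholdSubsetTriples
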